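import Literature.Analysis.FluidPDE.SelfSimilarLiouville
import Literature.Analysis.FluidPDE.HyperbolicDSSOrbit
import Literature.Analysis.FluidPDE.TypeIAncientMild
import Summits.NavierStokesRegularity.NavierStokesRegularity.Theorems.FilamentSkeletonRssRdssProfileTruncationSmoothRepresentative
import HarnessLib

/-!
# Crux `DssTruncationBridge` (stmt-NavierStokesRegularity-14477), line `registered` — stub 0
# `stub_smoothProfile_of_notLiouville` (the smooth Type-I rotated-DSS ancient profile)

If Tsai's Type-I (rotated) `λ`-DSS Liouville wall fails,
`¬ ∀ c, TypeIDSSLiouville c ∧ ∀ R, RotatedTypeIDSSLiouville c R`, then there is a Type-I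
rotated-DSS ancient profile with a jointly smooth representative, `IsTypeIDSSProfile c R u`
(`Literature.Analysis.FluidPDE.HyperbolicDSSOrbit`).

Proof. Some `c` violates either the plain statement — which is the rotated one for `R = 1`
(`rotatedTypeIDSSLiouville_refl_iff`) — or a rotated one; unfolding
`RotatedTypeIDSSLiouville c R` gives `1 < c` and a nontrivial Type-I rotated-DSS ancient mild
solution `u` with measurable slices. The in-tree normalisation theorem
`stub_rdssSmoothRepresentative` (Koch–Nadirashvili–Seregin–Šverák 2009, §4: regularity of the
representative) replaces `u` by an Oseen-gauge representative `u'` with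
`IsTypeIAncientMild C u'`, the same `(c, R)`-self-similarity, a Type-I bound and `u' t₀ x₀ ≠ 0`
for some `t₀ < 0`; the structure fields follow from the `IsTypeIAncientMild` API,
non-triviality because the continuous slice `u' t₀` cannot be a.e. zero (`Measure.eq_of_ae_eq`).
-/

noncomputable section

open MeasureTheory Set Filter Topology Function
open Literature.Analysis.FluidPDE

set_option linter.dupNamespace false

namespace Summit.NavierStokesRegularity.NavierStokesRegularity.Theorems

/-- Physical space `ℝ³` (the notation of the registered stub header). -/
local notation "E3" => EuclideanSpace ℝ (Fin 3)

/-- **Stub 0 of line `registered` of crux `DssTruncationBridge`**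
(stmt-NavierStokesRegularity-14477): failure of Tsai's Type-I (rotated) `λ`-DSS Liouville wall
yields a Type-I rotated-DSS ancient profile with a jointly smooth representative,
`IsTypeIDSSProfile c R u` (`1 < c`, ancient mild with `ν = 1`, measurable slices,
`IsRotatedDSS c R u`, a Type-I bound, not a.e. trivial on the slices `t < 0`, jointly `C^∞` on
`(−∞, 0) × ℝ³`). The plain-DSS disjunct is the case `R = 1` (`rotatedTypeIDSSLiouville_refl_iff`);
the smooth representative is `stub_rdssSmoothRepresentative` (KNSS 2009, §4, regularity of
bounded ancient mild solutions in the Oseen gauge).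
[cite: KochNadirashviliSereginSverak2009, §4] [cite: BradshawTsai2017CPDE, §5 Open Problem 5.1] -/
theorem stub_smoothProfile_of_notLiouville :
    (¬ ∀ c : ℝ, TypeIDSSLiouville c ∧ ∀ R : E3 ≃ₗᵢ[ℝ] E3, RotatedTypeIDSSLiouville c R) →
      ∃ (c : ℝ) (R : E3 ≃ₗᵢ[ℝ] E3) (u : ℝ → E3 → E3), IsTypeIDSSProfile c R u := by
  intro h
  -- Step 1: some `(c, R)` with `¬ RotatedTypeIDSSLiouville c R` (plain DSS is the case `R = 1`).
  obtain ⟨c, R, hcR⟩ : ∃ (c : ℝ) (R : E3 ≃ₗᵢ[ℝ] E3), ¬ RotatedTypeIDSSLiouville c R := by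
    by_contra hall
    refine h fun c => ⟨(rotatedTypeIDSSLiouville_refl_iff c).1 ?_, fun R => ?_⟩ <;>
      by_contra hno <;> exact hall ⟨c, _, hno⟩
  -- Step 2: unfold the rotated Liouville statement and extract a nontrivial witness.
  obtain ⟨hc, u, hu, hmeas, hdss, hdec, hnz⟩ :
      ∃ (_ : 1 < c) (u : ℝ → E3 → E3), IsAncientMildSolution 1 u ∧
        (∀ t < 0, AEStronglyMeasurable (u t) volume) ∧ IsRotatedDSS c R u ∧
        (∃ C₀ : ℝ, HasTypeIDecay C₀ u) ∧ ¬ ∀ t < 0, u t =ᵐ[volume] 0 := by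
    by_contra hcon
    refine hcR fun hc u hu hmeas hdss hdec => ?_
    by_contra hnz
    exact hcon ⟨hc, u, hu, hmeas, hdss, hdec, hnz⟩
  -- Step 3: the smooth Oseen-gauge representative (KNSS 2009, §4).
  obtain ⟨u', C, C₀, t₀, x₀, hT, hR, hdec', ht₀, hne⟩ :=
    stub_rdssSmoothRepresentative c R u hc hu hmeas hdss hdec hnz
  -- Step 4: assemble the profile; a continuous slice which is a.e. zero vanishes identically.
  refine ⟨c, R, u', ⟨hc, hT.isAncientMildSolution, fun t ht => hT.aestronglyMeasurable_slice ht,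
    hR, ⟨C₀, hdec'⟩, fun hzero => hne ?_, hT.contDiffOn⟩⟩
  have hEq : u' t₀ = 0 :=
    Measure.eq_of_ae_eq (hzero t₀ ht₀) (hT.continuous_slice ht₀) continuous_const
  rw [hEq, Pi.zero_apply]

end Summit.NavierStokesRegularity.NavierStokesRegularity.Theorems
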